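/-
Copyright (c) 2026 the pub-hodgecm-mathlib formalisation cell (harness21).  Prover seat hodgecm-mathlib-K2E2-p12 (g6): Track B «K2-LIT», ENGINE E1,
h413 = stmt-HodgeConjecture-24833; line `K2_E1_TraceFormulaBeta`, 5Res campaign «ENDGAME BY FAMILIES», ruling (R) of K2E1-plan (g7) 13:2xZ on `K2E1TauSphericalHeckeCommutativeU11` §2:
THE TRANSPOSE ANTI-AUTOMORPHISM `θ = ᵀ` OF `U(J)(E ⊗ ℝ)` (hypothesis-first in `J`: `c`-fixed entries, `J² = 1`) and the arch print of Gelfand's trick with the letter `hKconj`.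
-/
import Summits.HodgeConjecture.HodgeConjecture.Theorems.K2E1TauSphericalHeckeCommutativeU11   -- ★ p860461: Gelfand's trick (`integratedOperator_comm_of_spherical`), brings ★ `arch`, `cmDatum`
import Literature.NumberTheory.Automorphic.ArchRegularOrbitClosed                             -- ★ `conjMixed_conjMixed_of_apply_apply` (+ ★ `UnitaryGroupArchimedeanPlaces`: `conjMixed_mixedEmbedding`)
import HarnessLib

/-!
# K2·E1 — `K2E1ArchTransposeAntiAutU`: THE TRANSPOSE `g ↦ gᵀ` IS AN ANTI-AUTOMORPHIC HOMEOMORPHISM OF `U(J) = {g | (σg)ᵀ J g = J} ≤ GL_N(R)` WHENEVER `σ` IS AN INVOLUTION, `σJ = J` AND `J² = 1`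
# (E1: `U(J₂)(L ⊗ ℝ) = arch`, `J₂ = antidiag(1,1)`), AND THE ARCH PRINT OF GELFAND'S TRICK: `R_∞(f₁) R_∞(f₂) = R_∞(f₂) R_∞(f₁)` for `χ`-spherical `f₁, f₂` modulo the letter `hKconj`

Track B ∕ K2-LIT, crux h413 = `stmt-HodgeConjecture-24833`, route of record `HCCMUnconditional`; cell `hodgecm-mathlib`, squad K2, ENGINE E1 (5Res campaign, M2 v2 §3′.1; the arch letter
`hcommTau` of K2E4-p23's (β) skeleton).  THEOREMS ONLY (no `def`, no `instance`, no notation, no named-fact hypothesis, no `sorry`; default heartbeats); lane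
`--supports stmt-HodgeConjecture-24833 --as helper` (count-neutral).  CLOSES NO SOCKET.  `def`-free design: the transpose map is never named — §2 proves a homeomorphism `θ` with
`((θ g : GL) : Matrix) = ((g : GL) : Matrix)ᵀ` EXISTS, and §3–§4 derive everything from that characterising equation `hθT`, so a consumer binds `(θ) (hθT)` and discharges by §2.
* §1 (any commutative ring `R`, `σ : R →+* R`, `J`): **`map_mul_form_mul_transpose_eq`** — for `g ∈ U(J)` with `σ` an involution, `σJ = J`, `J² = 1`: `(σg) · J · gᵀ = J`, i.e. **`gᵀ ∈ U(J)`**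
  (in the form `((gᵀ).map σ)ᵀ J gᵀ = J`); `transpose_mul_transpose_inv` (`gᵀ (g⁻¹)ᵀ = 1`).
* §2 (topological `R`): **`exists_transposeHomeomorph`** — `∃ θ : U(J) ≃ₜ U(J), ∀ g, (θ g : Matrix) = (g : Matrix)ᵀ`.
* §3 from `hθT` alone: `theta_mul_rev` (ANTI-automorphism), `theta_theta` (involution), `theta_eq_self_of_transpose_eq` (`θ` fixes the symmetric elements — all of `K_∞` and of the split torus
  for `U(1,1)` in the antidiagonal frame).
* §4 E1 at `arch F E c N J = U(J ⊗ 1)(E ⊗ ℝ)`: ★ `conjMixed_conjMixed_of_apply_apply`, `archFormOf_map_conjMixed`, `archFormOf_mul_self` (the three §1 hypotheses from `c² = 1`, `J.map c = J`, `J² = 1`),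
  **`exists_transposeHomeomorph_arch`**, and THE PRINT **`integratedOperator_arch_comm_of_spherical`** — for any `θ` with `hθT`, Haar-type `η` on `arch` with `hθη : MeasurePreserving θ η η`,
  a compact `K →* arch` with multiplicative `χ`, and the LETTER `hKconj : ∀ g, ∃ k, θ g = κ k * g * (κ k)⁻¹` («every `g` is `K_∞`-conjugate to `gᵀ`», U(1,1): ★ p859876 transported —
  the successor's 2×2 computation): `σ(f₁) ∘ σ(f₂) = σ(f₂) ∘ σ(f₁)` for every unitary strongly continuous `σ` of `arch` and `χ`-spherical `f₁, f₂ ∈ C_c(arch)` (★ p860461).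
  `K_∞` may be taken as the Subgroup term `arch F E c N J ⊓ unitaryGroupOfForm (conjMixed F E c) 1` with `κ := Subgroup.inclusion inf_le_left` (`integratedOperator_arch_comm_of_spherical_unitaryPoints`).
HONEST LABEL: HC_CM is proved only modulo the 7 printed citations (2 remaining named inputs: hLiu418 = `stmt-HodgeConjecture-24832`, h413 = `stmt-HodgeConjecture-24833`) until rung 0
closes; this file asserts no named fact and closes no socket; count-neutral; unconditional.

## References
* [Helgason2000] S. Helgason, *Groups and Geometric Analysis* (AMS 2000): Ch. IV §3, Thm. 3.1 (Gelfand's trick with `g ↦ ᵗg`).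
* [Knapp1986] A. W. Knapp, *Representation Theory of Semisimple Groups* (1986): VIII §3.
* [BorelJacquet1979] A. Borel, H. Jacquet, PSPM 33.1 (1979): §4.1 (`U(J)(E ⊗ ℝ)`).
* [Rogawski1990] J. Rogawski, *Automorphic Representations of Unitary Groups in Three Variables* (1990): §3.1 p. 19 (the form `J`, `c ⊗ 1`).
-/

set_option autoImplicit false
set_option linter.dupNamespace false -- the mandated namespace repeats `HodgeConjecture.HodgeConjecture`

noncomputable section

open MeasureTheory Filter Topology CompactlySupported NumberField NumberField.mixedEmbedding
open Literature.NumberTheory.Automorphic Literature.NumberTheory.Automorphic.UnitaryGroup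
open Summit.HodgeConjecture.HodgeConjecture.Cruxes.H413.K2E1TauSphericalHeckeCommutativeU11 (integratedOperator_comm_of_spherical)
open scoped Matrix

namespace Summit.HodgeConjecture.HodgeConjecture.Cruxes.H413.K2E1ArchTransposeAntiAutU

/-! ## §1 `gᵀ ∈ U(J)` when `σ² = 1`, `σJ = J`, `J² = 1` -/

section Algebra

variable {R : Type*} [CommRing R] {N : ℕ} (σ : R →+* R) (J : Matrix (Fin N) (Fin N) R)

/-- `gᵀ · (g⁻¹)ᵀ = 1` and `(g⁻¹)ᵀ · gᵀ = 1` in `M_N(R)` for `g ∈ GL_N(R)`. [folklore] -/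
theorem transpose_mul_transpose_inv (g : GL (Fin N) R) :
    ((g : Matrix (Fin N) (Fin N) R))ᵀ * (((g⁻¹ : GL (Fin N) R) : Matrix (Fin N) (Fin N) R))ᵀ = 1 ∧
      (((g⁻¹ : GL (Fin N) R) : Matrix (Fin N) (Fin N) R))ᵀ * ((g : Matrix (Fin N) (Fin N) R))ᵀ = 1 := by
  constructor
  · rw [← Matrix.transpose_mul, ← Units.val_mul, inv_mul_cancel, Units.val_one, Matrix.transpose_one]
  · rw [← Matrix.transpose_mul, ← Units.val_mul, mul_inv_cancel, Units.val_one, Matrix.transpose_one]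

/-- **`gᵀ ∈ U(J)`**: if `σ` is an involution, `J` has `σ`-fixed entries and `J² = 1`, then `(σg)ᵀ J g = J` implies `((gᵀ).map σ)ᵀ · J · gᵀ = J`, i.e. `(σg) J gᵀ = J`.  PROOF: from `(σg)ᵀ J g = J`
and `J² = 1`, `g J (σg)ᵀ = J` (`J (σg)ᵀ J` is a left inverse of `g`, hence a right inverse); apply `σ` entrywise. [cite: Rogawski1990, §3.1 p. 19] [cite: BorelJacquet1979, §4.1] -/
theorem map_mul_form_mul_transpose_eq (hσ : ∀ x, σ (σ x) = x) (hJσ : J.map σ = J) (hJ2 : J * J = 1) {g : GL (Fin N) R} (hg : g ∈ unitaryGroupOfForm σ J) :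
    ((((g : Matrix (Fin N) (Fin N) R))ᵀ).map σ)ᵀ * J * ((g : Matrix (Fin N) (Fin N) R))ᵀ = J := by
  have hg' : (((g : Matrix (Fin N) (Fin N) R)).map σ)ᵀ * J * (g : Matrix (Fin N) (Fin N) R) = J := hg
  -- `(J (σg)ᵀ J) g = 1`, hence `g (J (σg)ᵀ J) = 1`
  have hL : J * (((g : Matrix (Fin N) (Fin N) R)).map σ)ᵀ * J * (g : Matrix (Fin N) (Fin N) R) = 1 := by
    have h := congrArg (fun M : Matrix (Fin N) (Fin N) R => J * M) hg'
    simp only [← Matrix.mul_assoc] at h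
    rw [h, hJ2]
  have hR : (g : Matrix (Fin N) (Fin N) R) * (J * (((g : Matrix (Fin N) (Fin N) R)).map σ)ᵀ * J) = 1 := mul_eq_one_comm.mp hL
  -- `g J (σg)ᵀ = J`
  have hGJA : (g : Matrix (Fin N) (Fin N) R) * J * (((g : Matrix (Fin N) (Fin N) R)).map σ)ᵀ = J := by
    have h := congrArg (fun M : Matrix (Fin N) (Fin N) R => M * J) hR
    simp only [Matrix.mul_assoc, Matrix.one_mul, hJ2, Matrix.mul_one] at h
    simpa only [Matrix.mul_assoc] using h
  -- apply `σ` entrywise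
  have hσσ : ((((g : Matrix (Fin N) (Fin N) R)).map σ)ᵀ).map σ = ((g : Matrix (Fin N) (Fin N) R))ᵀ := by
    rw [Matrix.transpose_map, Matrix.map_map]
    congr 1
    exact Matrix.ext fun i j => hσ _
  have hmap := congrArg (fun M : Matrix (Fin N) (Fin N) R => M.map σ) hGJA
  simp only [Matrix.map_mul, hJσ, hσσ] at hmap
  rw [Matrix.transpose_map, Matrix.transpose_transpose]
  exact hmap

end Algebra

/-! ## §2 The transpose homeomorphism of `U(J)` exists -/

section Topology

variable {R : Type*} [CommRing R] [TopologicalSpace R] [IsTopologicalRing R] {N : ℕ} (σ : R →+* R) (J : Matrix (Fin N) (Fin N) R)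

omit [IsTopologicalRing R] in
/-- **THE TRANSPOSE IS A HOMEOMORPHISM OF `U(J)`** (`σ` involution, `σJ = J`, `J² = 1`): there is `θ : U(J) ≃ₜ U(J)` with `(θ g : Matrix) = (g : Matrix)ᵀ` (an involution, continuous in the units
topology: `g ↦ gᵀ` and `g ↦ (g⁻¹)ᵀ` are continuous). [cite: Helgason2000, Ch. IV §3 Thm. 3.1] [cite: BorelJacquet1979, §4.1] -/
theorem exists_transposeHomeomorph (hσ : ∀ x, σ (σ x) = x) (hJσ : J.map σ = J) (hJ2 : J * J = 1) :
    ∃ θ : ↥(unitaryGroupOfForm σ J) ≃ₜ ↥(unitaryGroupOfForm σ J),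
      ∀ g : ↥(unitaryGroupOfForm σ J), (((θ g : ↥(unitaryGroupOfForm σ J)) : GL (Fin N) R) : Matrix (Fin N) (Fin N) R) = (((g : GL (Fin N) R) : Matrix (Fin N) (Fin N) R))ᵀ := by
  -- the transpose on `GL_N(R)` as a unit
  let T : GL (Fin N) R → GL (Fin N) R := fun g =>
    ⟨((g : Matrix (Fin N) (Fin N) R))ᵀ, (((g⁻¹ : GL (Fin N) R) : Matrix (Fin N) (Fin N) R))ᵀ, (transpose_mul_transpose_inv g).1, (transpose_mul_transpose_inv g).2⟩
  have hTval : ∀ g, ((T g : GL (Fin N) R) : Matrix (Fin N) (Fin N) R) = ((g : Matrix (Fin N) (Fin N) R))ᵀ := fun _ => rfl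
  have hTinv : ∀ g, (((T g)⁻¹ : GL (Fin N) R) : Matrix (Fin N) (Fin N) R) = (((g⁻¹ : GL (Fin N) R) : Matrix (Fin N) (Fin N) R))ᵀ := fun _ => rfl
  have hTT : ∀ g, T (T g) = g := fun g => Units.ext (by rw [hTval, hTval, Matrix.transpose_transpose])
  have hTc : Continuous T := by
    refine Units.continuous_iff.mpr ⟨?_, ?_⟩
    · exact (Units.continuous_val.matrix_transpose).congr fun g => (hTval g).symm
    · exact (Units.continuous_coe_inv.matrix_transpose).congr fun g => (hTinv g).symm
  have hTmem : ∀ g : ↥(unitaryGroupOfForm σ J), T g ∈ unitaryGroupOfForm σ J := fun g =>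
    map_mul_form_mul_transpose_eq σ J hσ hJσ hJ2 g.2
  let θ₀ : ↥(unitaryGroupOfForm σ J) → ↥(unitaryGroupOfForm σ J) := fun g => ⟨T g, hTmem g⟩
  have hθθ : ∀ g, θ₀ (θ₀ g) = g := fun g => Subtype.ext (hTT g)
  have hθc : Continuous θ₀ := (hTc.comp continuous_subtype_val).subtype_mk _
  exact ⟨{ toFun := θ₀, invFun := θ₀, left_inv := hθθ, right_inv := hθθ, continuous_toFun := hθc, continuous_invFun := hθc }, fun g => rfl⟩

end Topology

/-! ## §3 Consequences of the characterising equation `(θ g : Matrix) = (g : Matrix)ᵀ` -/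

section Consequences

variable {R : Type*} [CommRing R] {N : ℕ} {σ : R →+* R} {J : Matrix (Fin N) (Fin N) R}
  (θ : ↥(unitaryGroupOfForm σ J) → ↥(unitaryGroupOfForm σ J))
  (hθT : ∀ g : ↥(unitaryGroupOfForm σ J), (((θ g : ↥(unitaryGroupOfForm σ J)) : GL (Fin N) R) : Matrix (Fin N) (Fin N) R) = (((g : GL (Fin N) R) : Matrix (Fin N) (Fin N) R))ᵀ)

include hθT in
/-- **`θ` IS AN ANTI-AUTOMORPHISM**: `θ (x y) = θ y · θ x` (`(xy)ᵀ = yᵀ xᵀ`). [cite: Helgason2000, Ch. IV §3 Thm. 3.1] -/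
theorem theta_mul_rev (x y : ↥(unitaryGroupOfForm σ J)) : θ (x * y) = θ y * θ x := by
  refine Subtype.ext (Units.ext ?_)
  rw [hθT, Subgroup.coe_mul, Units.val_mul, Matrix.transpose_mul, Subgroup.coe_mul, Units.val_mul, hθT, hθT]

include hθT in
/-- **`θ` IS AN INVOLUTION**: `θ (θ g) = g`. [folklore] -/
theorem theta_theta (g : ↥(unitaryGroupOfForm σ J)) : θ (θ g) = g :=
  Subtype.ext (Units.ext (by rw [hθT, hθT, Matrix.transpose_transpose]))

include hθT in
/-- **`θ` FIXES THE SYMMETRIC ELEMENTS**: `gᵀ = g ⇒ θ g = g` (U(1,1), antidiagonal frame: all of `K_∞ = {[[a,b],[b,a]]}` and of the split torus `{diag(t,t⁻¹)}`). [cite: Helgason2000, Ch. IV §3 Thm. 3.1] -/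
theorem theta_eq_self_of_transpose_eq (g : ↥(unitaryGroupOfForm σ J)) (hg : (((g : GL (Fin N) R) : Matrix (Fin N) (Fin N) R))ᵀ = ((g : GL (Fin N) R) : Matrix (Fin N) (Fin N) R)) :
    θ g = g :=
  Subtype.ext (Units.ext (by rw [hθT, hg]))

end Consequences

/-! ## §4 E1: `arch F E c N J = U(J ⊗ 1)(E ⊗ ℝ)` and the print of Gelfand's trick -/

section Arch

variable (F E : Type) [Field F] [Field E] [NumberField E] [Algebra F E] (c : E ≃ₐ[F] E) (N : ℕ) (J : Matrix (Fin N) (Fin N) E)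

omit [NumberField E] in
/-- `J ⊗ 1` has `(c ⊗ 1)`-fixed entries when `J` has `c`-fixed entries (★ `conjMixed_mixedEmbedding`). [cite: Rogawski1990, §3.1 p. 19] -/
theorem archFormOf_map_conjMixed (hJc : J.map (c : E → E) = J) : (archFormOf E N J).map (conjMixed F E c) = archFormOf E N J := by
  rw [archFormOf, Matrix.map_map]
  have hcomp : (conjMixed F E c : mixedSpace E → mixedSpace E) ∘ (mixedEmbedding E : E → mixedSpace E) = (mixedEmbedding E : E → mixedSpace E) ∘ (c : E → E) :=
    funext fun x => by simp only [Function.comp_apply, conjMixed_mixedEmbedding]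
  rw [hcomp, ← Matrix.map_map, hJc]

omit [NumberField E] in
/-- `(J ⊗ 1)² = 1` when `J² = 1`. [folklore] -/
theorem archFormOf_mul_self (hJ2 : J * J = 1) : archFormOf E N J * archFormOf E N J = 1 := by
  rw [archFormOf, ← RingHom.mapMatrix_apply, ← map_mul, hJ2, map_one]

omit [NumberField E] in
/-- **THE TRANSPOSE HOMEOMORPHISM OF `U(J)(E ⊗ ℝ)` EXISTS** for `c` an involution, `J` with `c`-fixed entries and `J² = 1` (E1: `J₂ = antidiag(1,1)`, `c` complex conjugation of the CM field `L`).
[cite: Helgason2000, Ch. IV §3 Thm. 3.1] [cite: BorelJacquet1979, §4.1] -/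
theorem exists_transposeHomeomorph_arch (hc : ∀ x, c (c x) = x) (hJc : J.map (c : E → E) = J) (hJ2 : J * J = 1) :
    ∃ θ : ↥(arch F E c N J) ≃ₜ ↥(arch F E c N J),
      ∀ g : ↥(arch F E c N J), (((θ g : ↥(arch F E c N J)) : GL (Fin N) (mixedSpace E)) : Matrix (Fin N) (Fin N) (mixedSpace E)) =
        (((g : GL (Fin N) (mixedSpace E)) : Matrix (Fin N) (Fin N) (mixedSpace E)))ᵀ :=
  exists_transposeHomeomorph (conjMixed F E c) (archFormOf E N J) (conjMixed_conjMixed_of_apply_apply F E c hc) (archFormOf_map_conjMixed F E c N J hJc) (archFormOf_mul_self E N J hJ2)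

/-- **THE ARCH PRINT OF GELFAND'S TRICK (letter `hcommTau` modulo `hKconj`)**: for ANY `θ` on `arch` with `(θ g : Matrix) = (g : Matrix)ᵀ` (§4 `exists_transposeHomeomorph_arch`), a left- and
inversion-invariant `η` on `arch` preserved by `θ`, a compact `κ : K →* arch` with multiplicative `χ` (`χ 1 = 1`), and the LETTER `hKconj : ∀ g, ∃ k, θ g = κ k * g * (κ k)⁻¹` («`g` is `K_∞`-conjugate
to `gᵀ`»; U(1,1): ★ p859876), the `χ`-spherical Hecke operators of every unitary strongly continuous `σ` of `arch` commute: `σ(f₁) ∘ σ(f₂) = σ(f₂) ∘ σ(f₁)` (E1: `σ = π.restrict archToAdelic`, giving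
`R₁ f₁ ∘L R₁ f₂ = R₁ f₂ ∘L R₁ f₁`). [cite: Helgason2000, Ch. IV §3 Thm. 3.1] [cite: Knapp1986, VIII §3] -/
theorem integratedOperator_arch_comm_of_spherical
    [MeasurableSpace ↥(arch F E c N J)] [BorelSpace ↥(arch F E c N J)]
    (θ : ↥(arch F E c N J) ≃ₜ ↥(arch F E c N J))
    (hθT : ∀ g : ↥(arch F E c N J), (((θ g : ↥(arch F E c N J)) : GL (Fin N) (mixedSpace E)) : Matrix (Fin N) (Fin N) (mixedSpace E)) =
      (((g : GL (Fin N) (mixedSpace E)) : Matrix (Fin N) (Fin N) (mixedSpace E)))ᵀ)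
    (η : Measure ↥(arch F E c N J)) [IsFiniteMeasureOnCompacts η] [SFinite η] [η.IsMulLeftInvariant] [η.IsInvInvariant] (hθη : MeasurePreserving θ η η)
    {K : Type*} [Group K] (κ : K →* ↥(arch F E c N J)) (χ : K → ℂ) (hχmul : ∀ k l, χ (k * l) = χ k * χ l) (hχone : χ 1 = 1)
    (hKconj : ∀ g : ↥(arch F E c N J), ∃ k : K, θ g = κ k * g * (κ k)⁻¹)
    {V : Type*} [NormedAddCommGroup V] [InnerProductSpace ℂ V] [CompleteSpace V] (ρ : ContRepresentation ℂ ↥(arch F E c N J) V) (hu : ρ.IsUnitary) (hc' : ρ.IsStronglyContinuous)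
    (f₁ f₂ : C_c(↥(arch F E c N J), ℂ))
    (h₁l : ∀ (k : K) (x : ↥(arch F E c N J)), f₁ (κ k * x) = χ k * f₁ x) (h₁r : ∀ (k : K) (x : ↥(arch F E c N J)), f₁ (x * κ k) = χ k * f₁ x)
    (h₂l : ∀ (k : K) (x : ↥(arch F E c N J)), f₂ (κ k * x) = χ k * f₂ x) (h₂r : ∀ (k : K) (x : ↥(arch F E c N J)), f₂ (x * κ k) = χ k * f₂ x) :
    ρ.integratedOperator hu hc' η f₁ ∘L ρ.integratedOperator hu hc' η f₂ = ρ.integratedOperator hu hc' η f₂ ∘L ρ.integratedOperator hu hc' η f₁ :=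
  integratedOperator_comm_of_spherical θ (theta_mul_rev θ hθT) κ χ η hθη hχmul hχone hKconj ρ hu hc' f₁ f₂ h₁l h₁r h₂l h₂r

/-- **THE SAME WITH `K_∞ :=` THE UNITARY POINTS `arch ⊓ U(1 ⊗ 1)`** (`κ = Subgroup.inclusion inf_le_left`, the Subgroup term of ruling (R)); `hKconj` is then literally «`gᵀ = k g k⁻¹` with
`k ∈ U(J)(E⊗ℝ) ∩ U(N)`». [cite: Helgason2000, Ch. IV §3 Thm. 3.1] [cite: Knapp1986, VIII §3] -/
theorem integratedOperator_arch_comm_of_spherical_unitaryPoints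
    [MeasurableSpace ↥(arch F E c N J)] [BorelSpace ↥(arch F E c N J)]
    (θ : ↥(arch F E c N J) ≃ₜ ↥(arch F E c N J))
    (hθT : ∀ g : ↥(arch F E c N J), (((θ g : ↥(arch F E c N J)) : GL (Fin N) (mixedSpace E)) : Matrix (Fin N) (Fin N) (mixedSpace E)) =
      (((g : GL (Fin N) (mixedSpace E)) : Matrix (Fin N) (Fin N) (mixedSpace E)))ᵀ)
    (η : Measure ↥(arch F E c N J)) [IsFiniteMeasureOnCompacts η] [SFinite η] [η.IsMulLeftInvariant] [η.IsInvInvariant] (hθη : MeasurePreserving θ η η)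
    (χ : ↥(arch F E c N J ⊓ unitaryGroupOfForm (conjMixed F E c) 1) → ℂ) (hχmul : ∀ k l, χ (k * l) = χ k * χ l) (hχone : χ 1 = 1)
    (hKconj : ∀ g : ↥(arch F E c N J), ∃ k : ↥(arch F E c N J ⊓ unitaryGroupOfForm (conjMixed F E c) 1),
      θ g = Subgroup.inclusion inf_le_left k * g * (Subgroup.inclusion inf_le_left k)⁻¹)
    {V : Type*} [NormedAddCommGroup V] [InnerProductSpace ℂ V] [CompleteSpace V] (ρ : ContRepresentation ℂ ↥(arch F E c N J) V) (hu : ρ.IsUnitary) (hc' : ρ.IsStronglyContinuous)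
    (f₁ f₂ : C_c(↥(arch F E c N J), ℂ))
    (h₁l : ∀ (k : ↥(arch F E c N J ⊓ unitaryGroupOfForm (conjMixed F E c) 1)) (x : ↥(arch F E c N J)), f₁ (Subgroup.inclusion inf_le_left k * x) = χ k * f₁ x)
    (h₁r : ∀ (k : ↥(arch F E c N J ⊓ unitaryGroupOfForm (conjMixed F E c) 1)) (x : ↥(arch F E c N J)), f₁ (x * Subgroup.inclusion inf_le_left k) = χ k * f₁ x)
    (h₂l : ∀ (k : ↥(arch F E c N J ⊓ unitaryGroupOfForm (conjMixed F E c) 1)) (x : ↥(arch F E c N J)), f₂ (Subgroup.inclusion inf_le_left k * x) = χ k * f₂ x)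
    (h₂r : ∀ (k : ↥(arch F E c N J ⊓ unitaryGroupOfForm (conjMixed F E c) 1)) (x : ↥(arch F E c N J)), f₂ (x * Subgroup.inclusion inf_le_left k) = χ k * f₂ x) :
    ρ.integratedOperator hu hc' η f₁ ∘L ρ.integratedOperator hu hc' η f₂ = ρ.integratedOperator hu hc' η f₂ ∘L ρ.integratedOperator hu hc' η f₁ :=
  integratedOperator_arch_comm_of_spherical F E c N J θ hθT η hθη (Subgroup.inclusion inf_le_left) χ hχmul hχone hKconj ρ hu hc' f₁ f₂ h₁l h₁r h₂l h₂r

end Arch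

end Summit.HodgeConjecture.HodgeConjecture.Cruxes.H413.K2E1ArchTransposeAntiAutU

end
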